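import Mathlib
import Literature.Analysis.Matrix.EigenvalueCountCertificates
import HarnessLib

/-!
# Ventures/CertifiedQuantumChemistry — Rows/DominantPencilPSD.lean: positive semidefiniteness of a symmetric
# matrix PENCIL `L + η R₁ + η² R₂ + ⋯` for ALL small parameters `η`, from ONE margin `L − c·1 ⪰ 0` and the absolute
# row sums of the perturbation (the Gershgorin step of a polynomial-lift feasibility certificate)

HONEST FRAMING (verbatim): certified bounds for a stated model Hamiltonian in a stated basis; not a
claim about the real molecule beyond that model. Nothing in this file asserts a value, a row or a claim
node; it types the ANALYTIC STEP of a certificate format (theorems only, no data).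

Seat rdm-B (gen 41), zero compute. Motivation: the cell's exact LIFTS (`pub-qchem-rdmb/ab-files/v39/lift_L4_DQG.json`,
`…/v44/lift2_L6_DQG*.json`; STRUCTURE §2.2.14, §2.2.14.2–3) are polynomial families `y(ε) = y₀ + ε y₁ + ε² y₂` of points
of the finite-`U` DQG programmes (`ε = t/U`) whose feasibility FOR EVERY SMALL `ε` — hence `limsup_U U·OPT_DQG(L;U) ≤ v⋆`
and, with the tree's `U·E₀ → 4E₀(Heisenberg) − L`, the plateau-constant floors `liminf_U ĉ_DQG(4;U) ≥ √2 − 1`,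
`liminf_U ĉ_DQG(6;U) ≥ 1.24300…` — is so far certified only by the Python checkers `code/qchem_rdm_b/check_lift*.py`
(words + exact-certificate grade). Their analytic step, per symmetry block and after a congruence `T(η)`: the block is a
matrix POLYNOMIAL `P(η) = L + Σ_{m=1}^{k} η^m R_m` with `L ⪰ μ·1`, and `P(η) ⪰ 0` for `0 ≤ η ≤ η₀` because the
perturbation's operator norm is at most its largest absolute row sum. This file proves exactly that step over `ℝ`, in
the table-friendly form a kernel certificate can instantiate (all bounds are sums of absolute values of entries):

* §1 `abs_quadForm_le_of_rowSum` — for a SYMMETRIC real `E` with every absolute row sum `≤ ρ`: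
  `|xᵀ E x| ≤ ρ ‖x‖²` (the symmetric case of the Literature's Schur test
  `Literature.Analysis.Matrix.EigenvalueCount.abs_dotProduct_mulVec_le_of_abs_le_rowSum`, REUSED, not restated);
  `posSemidef_of_dominant` — `L − c·1 ⪰ 0`, `E` symmetric with absolute row sums `≤ c` ⇒ `L + E ⪰ 0`.
* §2 `rowSum_eval_le` — the absolute row sums of `Σ_m η^m R_m` are at most `Σ_m η^m ρ_m` (`ρ_m` = row-sum bounds
  of the coefficient tables, `η ≥ 0`); `posSemidef_pencil_of_dominant` — **`L − c·1 ⪰ 0`, every `R_m` symmetric with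
  absolute row sums `≤ ρ_m`, `0 ≤ η ≤ 1` and `η · Σ_m ρ_m ≤ c` ⇒ `L + Σ_{m=1}^{k} η^m R_m ⪰ 0`** — one margin, `k`
  row-sum tables and a linear condition on `η` certify the whole interval `[0, min(1, c/Σρ)]`.

0 `sorry`, 0 `def`, standard axioms. References (docstring-only): R. A. Horn, C. R. Johnson, Matrix Analysis (2nd
ed.) Thm 6.1.1 (Gershgorin) and §5.6 (`‖A‖₂² ≤ ‖A‖₁‖A‖_∞`); T. Kato, Perturbation Theory for Linear Operators
(1966) II §1 (analytic families — context only). Companions: `Rows/ExactLDLDecision.lean` (the margin `L − c·1 ⪰ 0`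
is decided by `ExactLDL.ldlAccept` on rational data), `Rows/BlockScatterPSD.lean` (blocks ⇒ whole matrix).
-/

namespace Summit.Ventures.CertifiedQuantumChemistry

namespace DominantPencil

open Matrix Finset

variable {n : Type*} [Fintype n] [DecidableEq n]

/-! ## §1 A symmetric perturbation with small absolute row sums does not destroy a margin -/

omit [DecidableEq n] in
/-- **Schur's row-sum bound, symmetric case**: if every absolute row sum of the SYMMETRIC real matrix `E` is at
most `ρ`, then `|xᵀ E x| ≤ ρ · Σ_i x_i²` — the Literature's two-sided Schur test
(`Literature.Analysis.Matrix.EigenvalueCount.abs_dotProduct_mulVec_le_of_abs_le_rowSum`, Horn–Johnson §5.6) with the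
dominating matrix `|E|`, whose column sums are its row sums by symmetry. -/
theorem abs_quadForm_le_of_rowSum (E : Matrix n n ℝ) (hE : E.IsSymm) (ρ : ℝ)
    (hrow : ∀ i, ∑ j, |E i j| ≤ ρ) (x : n → ℝ) :
    |x ⬝ᵥ (E *ᵥ x)| ≤ ρ * ∑ i, x i ^ 2 := by
  have hent : ∀ i j, E j i = E i j := fun i j => by
    have h := congrFun (congrFun hE i) j
    simpa [Matrix.transpose_apply] using h
  have hcol : ∀ j, ∑ i, |E i j| ≤ ρ := fun j =>
    calc ∑ i, |E i j| = ∑ i, |E j i| := Finset.sum_congr rfl fun i _ => by rw [hent j i]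
      _ ≤ ρ := hrow j
  have h := Literature.Analysis.Matrix.EigenvalueCount.abs_dotProduct_mulVec_le_of_abs_le_rowSum E
    (fun i j => |E i j|) (fun _ _ => le_rfl) hrow hcol x
  have hx : x ⬝ᵥ x = ∑ i, x i ^ 2 := by simp only [dotProduct, sq]
  rw [hx] at h
  exact h

/-- **A DOMINANT PART KEEPS THE SUM POSITIVE SEMIDEFINITE.** If `L − c·1 ⪰ 0` and `E` is symmetric with every
absolute row sum `≤ c`, then `L + E ⪰ 0` (real matrices). -/
theorem posSemidef_of_dominant (L E : Matrix n n ℝ) (c : ℝ) (hL : (L - c • (1 : Matrix n n ℝ)).PosSemidef)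
    (hE : E.IsSymm) (hrow : ∀ i, ∑ j, |E i j| ≤ c) : (L + E).PosSemidef := by
  have hc1 : (c • (1 : Matrix n n ℝ)).IsHermitian := by
    rw [Matrix.IsHermitian, Matrix.conjTranspose_smul, star_trivial, Matrix.conjTranspose_one]
  have hLh : L.IsHermitian := by
    have h := hL.1.add hc1
    rwa [sub_add_cancel] at h
  have hEh : E.IsHermitian := by
    rw [Matrix.IsHermitian, Matrix.conjTranspose_eq_transpose_of_trivial]; exact hE.eq
  refine Matrix.PosSemidef.of_dotProduct_mulVec_nonneg (hLh.add hEh) fun x => ?_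
  have hx : star x = x := by ext i; simp
  rw [hx, Matrix.add_mulVec, dotProduct_add]
  have h1 : c * ∑ i, x i ^ 2 ≤ x ⬝ᵥ (L *ᵥ x) := by
    have h := hL.dotProduct_mulVec_nonneg x
    rw [hx, Matrix.sub_mulVec, dotProduct_sub, Matrix.smul_mulVec, Matrix.one_mulVec, dotProduct_smul,
      smul_eq_mul] at h
    have e : x ⬝ᵥ x = ∑ i, x i ^ 2 := by simp [dotProduct, pow_two]
    rw [e] at h
    linarith
  have h2 := abs_quadForm_le_of_rowSum E hE c hrow x
  have h3 : -(c * ∑ i, x i ^ 2) ≤ x ⬝ᵥ (E *ᵥ x) := by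
    have := neg_abs_le (x ⬝ᵥ (E *ᵥ x)); linarith
  linarith

/-! ## §2 The pencil `L + Σ_{m=1}^{k} η^m R_m` on an interval of `η` -/

omit [DecidableEq n] in
/-- Absolute row sums of an evaluated matrix polynomial are at most the evaluated row-sum bounds (`η ≥ 0`). -/
theorem rowSum_eval_le {k : ℕ} (R : ℕ → Matrix n n ℝ) (ρ : ℕ → ℝ) (hρ : ∀ m < k, ∀ i, ∑ j, |R m i j| ≤ ρ m)
    {η : ℝ} (hη : 0 ≤ η) (i : n) :
    ∑ j, |(∑ m ∈ Finset.range k, η ^ (m + 1) • R m) i j| ≤ ∑ m ∈ Finset.range k, η ^ (m + 1) * ρ m := by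
  calc ∑ j, |(∑ m ∈ Finset.range k, η ^ (m + 1) • R m) i j|
      = ∑ j, |∑ m ∈ Finset.range k, η ^ (m + 1) * R m i j| := by
        refine Finset.sum_congr rfl fun j _ => ?_
        rw [Matrix.sum_apply]
        simp [Matrix.smul_apply]
    _ ≤ ∑ j, ∑ m ∈ Finset.range k, |η ^ (m + 1) * R m i j| :=
        Finset.sum_le_sum fun j _ => Finset.abs_sum_le_sum_abs _ _
    _ = ∑ m ∈ Finset.range k, η ^ (m + 1) * ∑ j, |R m i j| := by
        rw [Finset.sum_comm]
        refine Finset.sum_congr rfl fun m _ => ?_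
        rw [Finset.mul_sum]
        refine Finset.sum_congr rfl fun j _ => ?_
        rw [abs_mul, abs_of_nonneg (pow_nonneg hη _)]
    _ ≤ ∑ m ∈ Finset.range k, η ^ (m + 1) * ρ m :=
        Finset.sum_le_sum fun m hm => mul_le_mul_of_nonneg_left (hρ m (Finset.mem_range.1 hm) i) (pow_nonneg hη _)

/-- **THE PENCIL THEOREM.** Let `L − c·1 ⪰ 0`, let `R_0, …, R_{k−1}` be symmetric real matrices with absolute row sums
`≤ ρ_m` (`ρ_m ≥ 0`), and let `0 ≤ η ≤ 1` with `η · Σ_m ρ_m ≤ c`. Then `L + Σ_{m<k} η^{m+1} R_m ⪰ 0`. (With `η ≤ 1`,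
`η^{m+1} ≤ η`, so the linear condition dominates every power.) -/
theorem posSemidef_pencil_of_dominant {k : ℕ} (L : Matrix n n ℝ) (R : ℕ → Matrix n n ℝ) (c : ℝ) (ρ : ℕ → ℝ)
    (hL : (L - c • (1 : Matrix n n ℝ)).PosSemidef) (hR : ∀ m < k, (R m).IsSymm)
    (hρ : ∀ m < k, ∀ i, ∑ j, |R m i j| ≤ ρ m) (hρ0 : ∀ m < k, 0 ≤ ρ m)
    {η : ℝ} (hη0 : 0 ≤ η) (hη1 : η ≤ 1) (hηc : η * ∑ m ∈ Finset.range k, ρ m ≤ c) :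
    (L + ∑ m ∈ Finset.range k, η ^ (m + 1) • R m).PosSemidef := by
  refine posSemidef_of_dominant L _ c hL ?_ fun i => ?_
  · -- symmetry of the perturbation
    unfold Matrix.IsSymm
    rw [Matrix.transpose_sum]
    refine Finset.sum_congr rfl fun m hm => ?_
    rw [Matrix.transpose_smul, (hR m (Finset.mem_range.1 hm)).eq]
  · refine (rowSum_eval_le R ρ hρ hη0 i).trans ?_
    calc ∑ m ∈ Finset.range k, η ^ (m + 1) * ρ m ≤ ∑ m ∈ Finset.range k, η * ρ m := by
          refine Finset.sum_le_sum fun m hm => mul_le_mul_of_nonneg_right ?_ (hρ0 m (Finset.mem_range.1 hm))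
          calc η ^ (m + 1) = η ^ m * η := pow_succ η m
            _ ≤ 1 * η := mul_le_mul_of_nonneg_right (pow_le_one₀ hη0 hη1) hη0
            _ = η := one_mul η
      _ = η * ∑ m ∈ Finset.range k, ρ m := by rw [Finset.mul_sum]
      _ ≤ c := hηc

end DominantPencil

end Summit.Ventures.CertifiedQuantumChemistry
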